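import Summits.Ventures.PercRepro.S2MidFlatsTenB

/-!
# PercRepro — S2: THE MID SPANNING SETS AT CORANK `10` NUMBER AT MOST `1716·⌊(|E| − 8)/2⌋` (p7, gen 8; sub-claim S2)

The sharp form of S2MidFlatsTenB's `card_spanMid_le_ten` (`≤ 136,092` at `|E| = 31`). Same dichotomy: the closures of
the mid spanning sets are HEAVY rank-`5` flats (`12` or `13` points, `closure_mid_ten`); with two of them, `F₁ ≠ F₂`,
`W = cl(F₁ ∪ F₂)` is a rank-`6` flat of `≤ 16` points (`two_heavy_flats_ten` + the nullity cap). TOP (every heavy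
closure lies in `W`): every mid spanning set is a `6`-subset of `W`, so there are at most `C(|W|, 6) ≤ C(16, 6) = 8008`
of them — TenB instead summed `C(|F|, 6)` over the flats with a packing bound on their number (`≤ 136,092`). STAR (some
heavy closure leaves `W`): every heavy closure contains `K = F₁ ∩ F₂` and two of them meet exactly in `K`
(`heavy_triple_top_or_star`), so the remainders `F ∖ K` are pairwise disjoint subsets of `E ∖ K` with `≥ 2` points each;
`|K| = |F₁| + |F₂| − |F₁ ∪ F₂| ≥ 24 − 16 = 8`, hence `#𝓕 ≤ ⌊(|E| − 8)/2⌋` and the count is `≤ 1716·⌊(|E| − 8)/2⌋`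
(`C(13, 6) = 1716` per flat). With `|E| ≥ 18` the TOP bound `8008 ≤ 1716·5` is absorbed.
At `|E| = 27` (the cell `(17, 10)`): `≤ 15,444` against TenB/TenC's `136,092`; the mid term of the cell drops from
`0.36` to `0.04` of the denominator. Axioms: standard.
-/

open scoped Matroid

namespace PercRepro

namespace S2

open Set Finset

variable {α : Type} {M : Matroid α}

open scoped Classical in
/-- **The mid spanning sets at corank `10` number at most `1716·⌊(|E| − 8)/2⌋`** (`|E| ≥ 18`): TOP — all inside one
rank-`6` flat of `≤ 16` points, `≤ C(16, 6) = 8008`; STAR — `≤ ⌊(|E| − 8)/2⌋` heavy flats of `≤ 1716` sets each. -/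
theorem card_spanMid_le_ten_sharp [M.Finite]
    (hC1 : ∀ L ⊆ M.E, M.eRk L = 2 → L.ncard ≤ 3)
    (hflat' : ∀ X ⊆ M.E, M.eRk X ≤ ((5 - 1 : ℕ) : ℕ∞) → X.ncard ≤ 10)
    (hC2 : ∀ P ⊆ M.E, M.eRk P ≤ 3 → P.ncard ≤ 6) (hC0 : ∀ X ⊆ M.E, M.eRk X ≤ 1 → X.ncard ≤ 1)
    (hd : M.E.encard = M.eRank + 10) (hn : 18 ≤ M.E.ncard) :
    (spanMid M 5 10 9).card ≤ 1716 * ((M.E.ncard - 8) / 2) := by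
  have hfive : 5 ≤ (M.E.ncard - 8) / 2 := by omega
  set 𝓕 : Finset (Set α) := (spanMid M 5 10 9).image (fun S => M.closure S) with h𝓕
  have hdata : ∀ F ∈ 𝓕, F ⊆ M.E ∧ M.eRk F = 5 ∧ 12 ≤ F.ncard ∧ F.ncard ≤ 13 ∧ M.closure F = F := by
    intro F hF
    rw [h𝓕, Finset.mem_image] at hF
    obtain ⟨S, hS, rfl⟩ := hF
    obtain ⟨-, hr, hc1, hc2⟩ := closure_mid_ten hS
    exact ⟨M.closure_subset_ground _, hr, hc1, hc2, M.closure_closure _⟩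
  -- each closure `F` carries at most `C(|F|, 6) ≤ 1716` spanning sets
  have hper : ∀ F ∈ 𝓕, ((spanMid M 5 10 9).filter (fun S => M.closure S = F)).card ≤ 1716 := by
    intro F hF
    obtain ⟨hFE, -, -, hc2, -⟩ := hdata F hF
    have hFfin : F.Finite := M.ground_finite.subset hFE
    have k1 : ((spanMid M 5 10 9).filter (fun S => M.closure S = F)).card
        ≤ (Matroid.subsF hFfin.toFinset 6).card := by
      apply Finset.card_le_card
      intro S hS
      rw [Finset.mem_filter] at hS
      obtain ⟨hSm, hScl⟩ := hS
      obtain ⟨hSa, -, -, -⟩ := closure_mid_ten hSm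
      obtain ⟨hSE, hSc, -⟩ := mem_spanAll.1 hSa
      apply Matroid.mem_subsF_of _ hSc
      rw [Set.Finite.coe_toFinset, ← hScl]
      exact M.subset_closure S hSE
    have k2 := Matroid.card_subsF_le hFfin.toFinset 6
    rw [← Set.ncard_eq_toFinset_card _ hFfin] at k2
    have k3 : F.ncard.choose 6 ≤ (13 : ℕ).choose 6 := Nat.choose_mono 6 hc2
    have k4 : (13 : ℕ).choose 6 = 1716 := by decide
    omega
  have hsplit : (spanMid M 5 10 9).card ≤ 1716 * 𝓕.card := by
    have h1 : spanMid M 5 10 9 =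
        𝓕.biUnion (fun F => (spanMid M 5 10 9).filter (fun S => M.closure S = F)) := by
      ext S
      rw [Finset.mem_biUnion]
      constructor
      · intro hS
        exact ⟨M.closure S, Finset.mem_image_of_mem _ hS, Finset.mem_filter.2 ⟨hS, rfl⟩⟩
      · rintro ⟨F, -, hS⟩
        exact (Finset.mem_filter.1 hS).1
    rw [h1]
    refine Finset.card_biUnion_le.trans ?_
    calc ∑ F ∈ 𝓕, ((spanMid M 5 10 9).filter (fun S => M.closure S = F)).card
        ≤ ∑ _F ∈ 𝓕, 1716 := Finset.sum_le_sum hper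
      _ = 1716 * 𝓕.card := by rw [Finset.sum_const, smul_eq_mul, mul_comm]
  rcases Nat.lt_or_ge 𝓕.card 2 with hlt | hge
  · -- at most one heavy closure
    calc (spanMid M 5 10 9).card ≤ 1716 * 𝓕.card := hsplit
      _ ≤ 1716 * 1 := Nat.mul_le_mul_left _ (by omega)
      _ ≤ 1716 * ((M.E.ncard - 8) / 2) := Nat.mul_le_mul_left _ (by omega)
  obtain ⟨F₁, hF₁, F₂, hF₂, hne⟩ := Finset.one_lt_card.1 hge
  obtain ⟨h₁E, h₁r, h₁c, h₁c', h₁cl⟩ := hdata F₁ hF₁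
  obtain ⟨h₂E, h₂r, h₂c, h₂c', h₂cl⟩ := hdata F₂ hF₂
  obtain ⟨hI₁₂r, hI₁₂c, hU₁₂r⟩ :=
    two_heavy_flats_ten hC1 hflat' hC2 hC0 hd h₁E h₂E h₁r h₂r h₁c h₂c h₁cl h₂cl hne
  set W := M.closure (F₁ ∪ F₂) with hW
  have hWE : W ⊆ M.E := M.closure_subset_ground _
  have hWfin : W.Finite := M.ground_finite.subset hWE
  have hWcl : M.closure W = W := M.closure_closure _
  have hWr : M.eRk W = 6 := by rw [hW, M.eRk_closure_eq, hU₁₂r]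
  have hW₁ : F₁ ⊆ W := Set.subset_union_left.trans (M.subset_closure _ (Set.union_subset h₁E h₂E))
  have hW₂ : F₂ ⊆ W := Set.subset_union_right.trans (M.subset_closure _ (Set.union_subset h₁E h₂E))
  -- `|W| ≤ 16` by the nullity cap
  have hWc16 : W.ncard ≤ 16 := by
    have hcap := Matroid.encard_le_eRk_add_of_encard_eq (M := M) hWE hd
    rw [hWr, ← hWfin.cast_ncard_eq] at hcap
    exact_mod_cast hcap
  have h₁fin : F₁.Finite := M.ground_finite.subset h₁E
  have h₂fin : F₂.Finite := M.ground_finite.subset h₂E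
  -- `|F₁ ∩ F₂| ≥ 8`: `|F₁| + |F₂| = |F₁ ∪ F₂| + |F₁ ∩ F₂|` and `|F₁ ∪ F₂| ≤ |W| ≤ 16`
  have hK8 : 8 ≤ (F₁ ∩ F₂).ncard := by
    have hcard := Set.ncard_union_add_ncard_inter F₁ F₂ h₁fin h₂fin
    have hle : (F₁ ∪ F₂).ncard ≤ W.ncard := Set.ncard_le_ncard (Set.union_subset hW₁ hW₂) hWfin
    omega
  have hfin : ∀ F ∈ 𝓕, F.Finite := fun F hF => M.ground_finite.subset (hdata F hF).1
  by_cases hTop : ∀ F ∈ 𝓕, F ⊆ W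
  · -- TOP: every mid spanning set is a `6`-subset of `W`
    have hsub : (spanMid M 5 10 9).card ≤ (Matroid.subsF hWfin.toFinset 6).card := by
      apply Finset.card_le_card
      intro S hS
      obtain ⟨hSa, -, -, -⟩ := closure_mid_ten hS
      obtain ⟨hSE, hSc, -⟩ := mem_spanAll.1 hSa
      apply Matroid.mem_subsF_of _ hSc
      rw [Set.Finite.coe_toFinset]
      have hclW : M.closure S ⊆ W := hTop (M.closure S) (Finset.mem_image_of_mem _ hS)
      exact (M.subset_closure S hSE).trans hclW
    have k2 := Matroid.card_subsF_le hWfin.toFinset 6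
    rw [← Set.ncard_eq_toFinset_card _ hWfin] at k2
    have k3 : W.ncard.choose 6 ≤ (16 : ℕ).choose 6 := Nat.choose_mono 6 hWc16
    have k4 : (16 : ℕ).choose 6 = 8008 := by decide
    have k5 : 8008 ≤ 1716 * ((M.E.ncard - 8) / 2) := by
      calc 8008 ≤ 1716 * 5 := by norm_num
        _ ≤ 1716 * ((M.E.ncard - 8) / 2) := Nat.mul_le_mul_left _ hfive
    omega
  · -- STAR: some closure leaves `W`; every closure contains `K = F₁ ∩ F₂`, pairwise meeting exactly in `K`
    push Not at hTop
    obtain ⟨F₃, hF₃, hF₃W⟩ := hTop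
    obtain ⟨h₃E, h₃r, h₃c, h₃c', h₃cl⟩ := hdata F₃ hF₃
    have h₁₃ : F₁ ≠ F₃ := fun h => hF₃W (h ▸ hW₁)
    have h₂₃ : F₂ ≠ F₃ := fun h => hF₃W (h ▸ hW₂)
    set K := F₁ ∩ F₂ with hK
    have hKcl : M.closure K = K := closure_inter_eq_of_closure_eq h₁cl h₂cl
    have hKE : K ⊆ M.E := Set.inter_subset_left.trans h₁E
    obtain ⟨hK₁₃, hK₂₃⟩ :=
      (heavy_triple_top_or_star hC1 hflat' hC2 hC0 hd h₁E h₂E h₃E h₁r h₂r h₃r h₁c h₂c h₃c h₁cl h₂cl h₃cl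
        hne h₁₃ h₂₃).resolve_left hF₃W
    -- every other closure meets `F₁` exactly in `K`
    have hK₁ : ∀ F ∈ 𝓕, F ≠ F₁ → F₁ ∩ F = K := by
      intro F hF hF₁
      obtain ⟨hFE, hFr, hFc, -, hFcl⟩ := hdata F hF
      by_cases hF₂ : F = F₂
      · rw [hF₂]
      by_cases hF₃' : F = F₃
      · rw [hF₃']; exact hK₁₃
      rcases heavy_triple_top_or_star hC1 hflat' hC2 hC0 hd h₁E h₂E hFE h₁r h₂r hFr h₁c h₂c hFc h₁cl h₂cl hFcl
          hne (Ne.symm hF₁) (Ne.symm hF₂) with hT₁₂ | ⟨hs, -⟩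
      · rcases heavy_triple_top_or_star hC1 hflat' hC2 hC0 hd h₁E h₃E hFE h₁r h₃r hFr h₁c h₃c hFc h₁cl h₃cl
            hFcl h₁₃ (Ne.symm hF₁) (Ne.symm hF₃') with hT₁₃ | ⟨hs, -⟩
        · -- `F` lies in both rank-`6` hulls, which meet exactly in `F₁`
          exfalso
          set W' := M.closure (F₁ ∪ F₃) with hW'
          obtain ⟨-, -, hU₁₃r⟩ :=
            two_heavy_flats_ten hC1 hflat' hC2 hC0 hd h₁E h₃E h₁r h₃r h₁c h₃c h₁cl h₃cl h₁₃
          have hW'r : M.eRk W' = 6 := by rw [hW', M.eRk_closure_eq, hU₁₃r]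
          have hW'cl : M.closure W' = W' := M.closure_closure _
          have hW'E : W' ⊆ M.E := M.closure_subset_ground _
          have hJcl : M.closure (W ∩ W') = W ∩ W' := closure_inter_eq_of_closure_eq hWcl hW'cl
          have hJE : W ∩ W' ⊆ M.E := Set.inter_subset_left.trans hWE
          have hF₁J : F₁ ⊆ W ∩ W' :=
            Set.subset_inter hW₁ (Set.subset_union_left.trans (M.subset_closure _ (Set.union_subset h₁E h₃E)))
          have hJr : M.eRk (W ∩ W') ≤ 5 := by
            by_contra hcon
            push Not at hcon
            have hJr6 : M.eRk W ≤ M.eRk (W ∩ W') := by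
              rw [hWr]
              exact Order.add_one_le_of_lt hcon
            have hJW : W ∩ W' = W :=
              flat_eq_of_subset_of_eRk_eq hJE hJcl hWcl Set.inter_subset_left hJr6
            have hWW' : W ⊆ W' := by rw [← hJW]; exact Set.inter_subset_right
            have hWeq : W = W' :=
              flat_eq_of_subset_of_eRk_eq hWE hWcl hW'cl hWW' (by rw [hWr, hW'r])
            exact hF₃W (hWeq ▸ Set.subset_union_right.trans (M.subset_closure _ (Set.union_subset h₁E h₃E)))
          have hJF₁ : F₁ = W ∩ W' :=
            flat_eq_of_subset_of_eRk_eq h₁E h₁cl hJcl hF₁J (by rw [h₁r]; exact hJr)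
          have hFF₁ : F ⊆ F₁ := by rw [hJF₁]; exact Set.subset_inter hT₁₂ hT₁₃
          exact hF₁ (flat_eq_of_subset_of_eRk_eq hFE hFcl h₁cl hFF₁ (by rw [h₁r, hFr]))
        · rw [hs, hK₁₃]
      · exact hs
    -- hence every closure contains `K`, and two distinct closures meet exactly in `K`
    have hKsub : ∀ F ∈ 𝓕, K ⊆ F := by
      intro F hF
      by_cases hF₁ : F = F₁
      · rw [hF₁]; exact Set.inter_subset_left
      · rw [← hK₁ F hF hF₁]; exact Set.inter_subset_right
    have hKpair : ∀ F ∈ 𝓕, ∀ F' ∈ 𝓕, F ≠ F' → F ∩ F' = K := by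
      intro F hF F' hF' hne'
      obtain ⟨hFE, hFr, hFc, -, hFcl⟩ := hdata F hF
      obtain ⟨hF'E, hF'r, hF'c, -, hF'cl⟩ := hdata F' hF'
      obtain ⟨hIr, -, -⟩ := two_heavy_flats_ten hC1 hflat' hC2 hC0 hd hFE hF'E hFr hF'r hFc hF'c hFcl hF'cl hne'
      have hIcl : M.closure (F ∩ F') = F ∩ F' := closure_inter_eq_of_closure_eq hFcl hF'cl
      exact (flat_eq_of_subset_of_eRk_eq hKE hKcl hIcl (Set.subset_inter (hKsub F hF) (hKsub F' hF'))
        (by rw [hIr, hI₁₂r])).symm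
    -- the remainders `F ∖ K` are pairwise disjoint, with `≥ 2` points each, inside `E ∖ K`
    have hEfin : M.E.Finite := M.ground_finite
    have hKfin : K.Finite := M.ground_finite.subset hKE
    let dF : Set α → Finset α := fun F => hEfin.toFinset.filter (fun x => x ∈ F ∧ x ∉ K)
    have hdF : ∀ F ∈ 𝓕, 2 ≤ (dF F).card := by
      intro F hF
      obtain ⟨hFE, -, hFc, -, -⟩ := hdata F hF
      have hFfin : F.Finite := hfin F hF
      have hdiff : dF F = (hFfin.sdiff (t := K)).toFinset := by
        ext x
        simp only [dF, Finset.mem_filter, Set.Finite.mem_toFinset, Set.mem_sdiff]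
        exact ⟨fun h => h.2, fun h => ⟨hFE h.1, h⟩⟩
      rw [hdiff, ← Set.ncard_eq_toFinset_card _ (hFfin.sdiff), Set.ncard_sdiff (hKsub F hF) hKfin]
      omega
    have hdFdisj : ∀ F ∈ 𝓕, ∀ F' ∈ 𝓕, F ≠ F' → Disjoint (dF F) (dF F') := by
      intro F hF F' hF' hne'
      rw [Finset.disjoint_left]
      intro x hx hx'
      simp only [dF, Finset.mem_filter] at hx hx'
      have : x ∈ F ∩ F' := ⟨hx.2.1, hx'.2.1⟩
      rw [hKpair F hF F' hF' hne'] at this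
      exact hx.2.2 this
    have hbiE := Finset.card_biUnion (s := 𝓕) (t := dF) hdFdisj
    -- the union of the remainders is disjoint from `K` inside `E`: `|⋃ dF| + |K| ≤ |E|`
    have hunionK : (𝓕.biUnion dF).card + K.ncard ≤ M.E.ncard := by
      have hdisjK : Disjoint (𝓕.biUnion dF) hKfin.toFinset := by
        rw [Finset.disjoint_left]
        intro x hx hxK
        rw [Finset.mem_biUnion] at hx
        obtain ⟨F, -, hx⟩ := hx
        rw [Set.Finite.mem_toFinset] at hxK
        exact (Finset.mem_filter.1 hx).2.2 hxK
      have hsubE : (𝓕.biUnion dF) ∪ hKfin.toFinset ⊆ hEfin.toFinset := by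
        intro x hx
        rw [Finset.mem_union] at hx
        rcases hx with hx | hx
        · rw [Finset.mem_biUnion] at hx
          obtain ⟨F, -, hx⟩ := hx
          exact (Finset.mem_filter.1 hx).1
        · rw [Set.Finite.mem_toFinset] at hx ⊢
          exact hKE hx
      have hcardU := Finset.card_union_of_disjoint hdisjK
      have hle := Finset.card_le_card hsubE
      rw [hcardU, ← Set.ncard_eq_toFinset_card _ hKfin, ← Set.ncard_eq_toFinset_card _ hEfin] at hle
      exact hle
    have hsumE : 𝓕.card * 2 ≤ ∑ F ∈ 𝓕, (dF F).card := by
      rw [← smul_eq_mul, ← Finset.sum_const]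
      exact Finset.sum_le_sum hdF
    rw [← hbiE] at hsumE
    -- `2·#𝓕 + 8 ≤ |E|`, hence `#𝓕 ≤ ⌊(|E| − 8)/2⌋`
    have hF2 : 𝓕.card ≤ (M.E.ncard - 8) / 2 := by
      rw [Nat.le_div_iff_mul_le (by norm_num)]
      omega
    calc (spanMid M 5 10 9).card ≤ 1716 * 𝓕.card := hsplit
      _ ≤ 1716 * ((M.E.ncard - 8) / 2) := Nat.mul_le_mul_left _ hF2

end S2

end PercRepro
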